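import Literature.Topology.FourManifolds.SphereProductTubeCollapse
import Literature.Topology.FourManifolds.SphereProductThomKronecker
import HarnessLib

/-!
# The vertex data of the `E₈` plumbing in the model `S²ᵐ × S²ᵐ ⊃` tube of the diagonal

Topic `Literature/Topology/FourManifolds` (fact seat of
`Literature.Topology.FourManifolds.HomotopySphere.exists_intersectionForm_equivalent_e8Form`,
Kosinski's `E₈` plumbing `M(4m)`, *Differential Manifolds* (1993), VI.12). This file only
ASSEMBLES, for the consumer of the Kronecker form of the `E₈` table
(`HomotopySphere.exists_intersectionForm_equivalent_e8Form_of_kroneckerData`,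
`HomotopySpheresE8KroneckerTable.lean`), the model-side data of one vertex: the relative
fundamental class `w` of the tube `N_c` induced by an orientation `μ` of `Sᵏ × Sᵏ` together with
the collapse `c₊ [Sᵏ × Sᵏ]_μ = ẑ_w` (`Tube.exists_collapse_fundamentalClass`,
`SphereProductTubeCollapse.lean`), the Thom class `ξ` (`exists_thomClass`,
`SphereProductThomCollapse.lean`) and its cap product and Kronecker numbers
(`SphereProductThomKronecker.lean`): `SphereProd.Tube.exists_vertexData`. What is left to the
constructor of the plumbing is purely combinatorial-geometric: the collapses of the glued
manifold onto the pieces (by `NullCobordism.exists_ambientCollapse` with the local datum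
provided here), the core spheres, and which sphere meets which tube in a fibre.

Everything is proved; no definitions, no named facts (D-0026).

## References

* A. Kosinski, *Differential Manifolds* (1993), VI.12, pp. 119–122, (12.3)–(12.4). [Kosinski1993]
* J. Milnor, J. Stasheff, *Characteristic classes* (1974), §11 Thm. 11.1, Cor. 11.2, §18 p. 205.
  [MilnorStasheff1974]
* A. Hatcher, *Algebraic Topology* (2002), §3.3 Thm. 3.26(a), p. 241. [HatcherAT2002]
-/

open scoped Manifold ContDiff Topology
open Set Function CategoryTheory CategoryTheory.Limits Topology

noncomputable section

namespace Literature.Topology.FourManifolds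

open Literature.AlgebraicTopology.SingularHomology Literature.Geometry.Manifold

namespace SphereProd

variable {k m : ℕ} {hkm : k + k = m + 1 + 1} {c : ℝ} (hc : |c| < 1)

-- Heartbeat headroom (2026-08-16 full-build breakage): the statement-heavy vertex packages elaborate in
-- 400k–800k heartbeats (probe: fail at 400000, pass at 800000 on the farm; the 2026-08-16 full build timed
-- out at 800000 inside `Tube.exists_vertexData`), i.e. at the former cap; doubled, proofs unchanged.
set_option maxHeartbeats 1600000 in
/-- **The vertex data of the `E₈` plumbing in the model `S²ᵐ × S²ᵐ ⊃ N_c`** (Kosinski 1993,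
VI.12, (12.3)–(12.4)), packaged for the Kronecker form of the table
(`HomotopySphere.exists_intersectionForm_equivalent_e8Form_of_kroneckerData`). For `k ≥ 2` even,
`|c| < 1` and a `ℤ`-orientation `μ` of `Sᵏ × Sᵏ` in degree `m + 2 = 2k` there are a relative
fundamental class `w` of the tube `(N_c, ∂N_c)`, a class `ξ ∈ Hᵏ(N̂_c; ℤ)` of its Thom space /
closed model and a sign `r = ±1` such that: `ξ` vanishes off the image of the diagonal; the local
classes of `ẑ_w` at the finite points and of `μ` come from one class on `int N_c` (the datum
`hloc` of `NullCobordism.exists_ambientCollapse` for any further collapse onto `N̂_c`); the Thom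
collapse `c : Sᵏ × Sᵏ → N̂_c` (`SphereProd.tubeCollapse`) carries `[Sᵏ × Sᵏ]_μ` to `ẑ_w`; and, with
`t = c₊ diag₊[Sᵏ]` the collapsed core sphere,
`ξ ⌢ ẑ_w = r • t`, `⟨ξ, t⟩ = 2`, `⟨ξ, c₊ (slice through any pole)₊[Sᵏ]⟩ = 1`, and `t` is not
torsion. (Assembled from `Tube.exists_collapse_fundamentalClass`, `exists_thomClass` and
`SphereProductThomKronecker.lean`.)
[cite: Kosinski1993, VI.12 pp. 119–122, (12.3)–(12.4)] [cite: MilnorStasheff1974, §11 Thm. 11.1, Cor. 11.2] [cite: HatcherAT2002, §3.3 Thm. 3.26(a), p. 241] -/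
theorem Tube.exists_vertexData (hk : 2 ≤ k) (hke : Even k)
    (μ : HomologicalOrientation ℤ ((Metric.sphere (0 : EuclideanSpace ℝ (Fin (k + 1))) 1) ×
      (Metric.sphere (0 : EuclideanSpace ℝ (Fin (k + 1))) 1)) (m + 1 + 1)) :
    ∃ (w : relativeSingularHomology ℤ ℤ (Tube k (m + 1) hkm hc)
        ((𝓡∂ (m + 1 + 1)).boundary (Tube k (m + 1) hkm hc)) (m + 1 + 1))
      (ξ : singularCohomology ℤ ℤ (ThomSp k (m + 1) hkm hc) k) (r : ℤ),
      IsRelFundamentalClass ℤ ((𝓡∂ (m + 1 + 1)).boundary (Tube k (m + 1) hkm hc)) w ∧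
      (r = 1 ∨ r = -1) ∧
      singularCohomology.map ℤ ℤ (subsetIncl (thomDiag (openTubeHomeomorph (hkn := hkm) hc))ᶜ) k ξ = 0 ∧
      (∀ y : ManifoldInterior (m + 1) (Tube k (m + 1) hkm hc),
        ∃ ζ : localHomology ℤ ℤ (ManifoldInterior (m + 1) (Tube k (m + 1) hkm hc)) y (m + 1 + 1),
          relativeSingularHomology.map ℤ ℤ
              (⟨fun y : ManifoldInterior (m + 1) (Tube k (m + 1) hkm hc) => Tube.toProd hc y.1,
                (contMDiff_out.continuous.comp (RegularSublevel.continuous_incl _)).comp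
                  continuous_subtype_val⟩ : C(_, _))
              (LocalFamily.mapsTo_compl_pt ((Tube.toProd_injective hc).comp Subtype.val_injective) y)
              (m + 1 + 1) ζ = μ.localClass (Tube.toProd hc y.1) ∧
          singularHomology.toLocal ℤ ℤ (ClosedModel.ofInterior y) (m + 1 + 1)
              ((SmaleHomologySpheres.nullCobordismOfBoundary (m + 1)
                (Tube k (m + 1) hkm hc)).closedModelClass ℤ ℤ (Nat.le_add_left 1 m) w) =
            relativeSingularHomology.map ℤ ℤ (NullCobordism.ofInteriorCM
                (SmaleHomologySpheres.nullCobordismOfBoundary (m + 1) (Tube k (m + 1) hkm hc)))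
              (LocalFamily.mapsTo_compl_pt (NullCobordism.isOpenEmbedding_ofInteriorCM _).injective y)
              (m + 1 + 1) ζ) ∧
      singularHomology.map ℤ ℤ (tubeCollapse (hkn := hkm) hc) (m + 1 + 1) μ.fundamentalClass =
        (SmaleHomologySpheres.nullCobordismOfBoundary (m + 1)
          (Tube k (m + 1) hkm hc)).closedModelClass ℤ ℤ (Nat.le_add_left 1 m) w ∧
      capProduct hkm ξ ((SmaleHomologySpheres.nullCobordismOfBoundary (m + 1)
          (Tube k (m + 1) hkm hc)).closedModelClass ℤ ℤ (Nat.le_add_left 1 m) w) =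
        r • singularHomology.map ℤ ℤ (tubeCollapse (hkn := hkm) hc) k
          (singularHomology.map ℤ ℤ (diagX k) k (μS hk).fundamentalClass) ∧
      kroneckerPairing ℤ ℤ (ThomSp k (m + 1) hkm hc) k ξ
          (singularHomology.map ℤ ℤ (tubeCollapse (hkn := hkm) hc) k
            (singularHomology.map ℤ ℤ (diagX k) k (μS hk).fundamentalClass)) = 2 ∧
      (∀ e : Metric.sphere (0 : EuclideanSpace ℝ (Fin (k + 1))) 1,
        kroneckerPairing ℤ ℤ (ThomSp k (m + 1) hkm hc) k ξ (singularHomology.map ℤ ℤ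
            ((tubeCollapse (hkn := hkm) hc).comp ⟨fun x => (x, e), by fun_prop⟩) k
              (μS hk).fundamentalClass) = 1 ∧
        kroneckerPairing ℤ ℤ (ThomSp k (m + 1) hkm hc) k ξ (singularHomology.map ℤ ℤ
            ((tubeCollapse (hkn := hkm) hc).comp ⟨fun x => (e, x), by fun_prop⟩) k
              (μS hk).fundamentalClass) = 1) ∧
      (∀ a : ℤ, a • singularHomology.map ℤ ℤ (tubeCollapse (hkn := hkm) hc) k
          (singularHomology.map ℤ ℤ (diagX k) k (μS hk).fundamentalClass) = 0 → a = 0) := by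
  have hc1 : c < 1 := (abs_lt.1 hc).2
  have hΔ : diagonal k ⊆ openTube k c := diagonal_subset_openTube hc1
  -- the Thom class
  obtain ⟨ξ, hξA, hξB⟩ := exists_thomClass (isOpen_openTube k c) (openTubeHomeomorph (hkn := hkm) hc)
    hk hke hΔ
  -- the collapse and the `μ`-induced relative fundamental class (read on `PM = Sᵏ × Sᵏ`)
  have H := Tube.exists_collapse_fundamentalClass (k := k) (m := m) (hkm := hkm) hc hk
    (μ : HomologicalOrientation ℤ (PM k (m + 1) hkm) (m + 1 + 1))
  obtain ⟨π, w, hH⟩ := H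
  have hπq := hH.1
  have hπN := hH.2.1
  have hw := hH.2.2.2.1
  have hLof := hH.2.2.2.2.2.1
  have hclass := hH.2.2.2.2.2.2
  -- the two collapses agree
  have hπc : ∀ x : (Metric.sphere (0 : EuclideanSpace ℝ (Fin (k + 1))) 1) ×
      (Metric.sphere (0 : EuclideanSpace ℝ (Fin (k + 1))) 1),
      π x = tubeCollapse (hkn := hkm) hc x := by
    intro x
    by_cases hx : x ∈ openTube k c
    · have h1 := tubeCollapse_coe (hkn := hkm) hc ⟨x, hx⟩
      refine Eq.trans ?_ h1.symm
      have h2 := hπq (Tube.ofProd hc x (le_of_lt hx))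
      refine h2.trans ?_
      exact boundaryCollapse_of_mem_interior _
    · rw [tubeCollapse_of_not_mem (hkn := hkm) hc hx]
      exact hπN x (not_lt.1 hx)
  have hπeq : (show C((Metric.sphere (0 : EuclideanSpace ℝ (Fin (k + 1))) 1) ×
      (Metric.sphere (0 : EuclideanSpace ℝ (Fin (k + 1))) 1), ThomSp k (m + 1) hkm hc) from π) =
      (thomCollapse (isOpen_openTube k c) (openTubeHomeomorph (hkn := hkm) hc)) := by
    ext x : 1; exact hπc x
  have hclassS : singularHomology.map ℤ ℤ (show C((Metric.sphere (0 : EuclideanSpace ℝ (Fin (k + 1))) 1) ×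
      (Metric.sphere (0 : EuclideanSpace ℝ (Fin (k + 1))) 1), ThomSp k (m + 1) hkm hc) from π)
      (m + 1 + 1) μ.fundamentalClass =
      (SmaleHomologySpheres.nullCobordismOfBoundary (m + 1)
        (Tube k (m + 1) hkm hc)).closedModelClass ℤ ℤ (Nat.le_add_left 1 m) w := hclass
  rw [hπeq] at hclassS
  -- the model sign `r = ⟨g₁ ⌣ g₂, [X]⟩ = ±1`
  have hrabs : |(kroneckerPairing ℤ ℤ ((Metric.sphere (0 : EuclideanSpace ℝ (Fin (k + 1))) 1) × (Metric.sphere (0 : EuclideanSpace ℝ (Fin (k + 1))) 1)) (m + 1 + 1) (cupProduct hkm (g hk 0) (g hk 1)) μ.fundamentalClass)| = 1 := abs_kroneckerPairing_cupProduct_g hk hkm μ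
  have hr1 : (kroneckerPairing ℤ ℤ ((Metric.sphere (0 : EuclideanSpace ℝ (Fin (k + 1))) 1) × (Metric.sphere (0 : EuclideanSpace ℝ (Fin (k + 1))) 1)) (m + 1 + 1) (cupProduct hkm (g hk 0) (g hk 1)) μ.fundamentalClass) = 1 ∨
      (kroneckerPairing ℤ ℤ ((Metric.sphere (0 : EuclideanSpace ℝ (Fin (k + 1))) 1) × (Metric.sphere (0 : EuclideanSpace ℝ (Fin (k + 1))) 1)) (m + 1 + 1) (cupProduct hkm (g hk 0) (g hk 1)) μ.fundamentalClass) = -1 := (abs_eq zero_le_one).1 hrabs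
  -- (`tubeCollapse hc` unfolds to `thomCollapse (isOpen_openTube k c) (openTubeHomeomorph hc)`)
  have hcap := capProduct_thomClass_map_fundamentalClass (isOpen_openTube k c)
    (openTubeHomeomorph (hkn := hkm) hc) hk hke hΔ hkm μ hξA hξB
  have hdiag := kroneckerPairing_thomClass_map_y_add_y (isOpen_openTube k c)
    (openTubeHomeomorph (hkn := hkm) hc) hk hke hΔ hξA hξB
  have hslice := kroneckerPairing_thomClass_map_sliceAt (isOpen_openTube k c)
    (openTubeHomeomorph (hkn := hkm) hc) hk hke hΔ hξA hξB
  have htors := eq_zero_of_zsmul_map_y_add_y_eq_zero (isOpen_openTube k c)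
    (openTubeHomeomorph (hkn := hkm) hc) hk hke hΔ hξA hξB
  have hcap' := (congrArg (capProduct hkm ξ) hclassS).symm.trans hcap
  refine ⟨w, ξ, (kroneckerPairing ℤ ℤ ((Metric.sphere (0 : EuclideanSpace ℝ (Fin (k + 1))) 1) × (Metric.sphere (0 : EuclideanSpace ℝ (Fin (k + 1))) 1)) (m + 1 + 1) (cupProduct hkm (g hk 0) (g hk 1)) μ.fundamentalClass), ?_, ?_, ?_, fun y => ?_, ?_, ?_, ?_, ?_, fun a ha => ?_⟩
  · exact hw
  · exact hr1
  · exact hξB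
  · exact hLof y
  · exact hclassS
  · rw [hcap', map_diagX_fundamentalClass hk]
    rfl
  · rw [map_diagX_fundamentalClass hk]; exact hdiag
  · exact hslice
  · have e := congrArg (singularHomology.map ℤ ℤ
      (thomCollapse (isOpen_openTube k c) (openTubeHomeomorph (hkn := hkm) hc)) k)
      (map_diagX_fundamentalClass hk)
    exact htors a ((congrArg (fun x => a • x) e).symm.trans ha)

set_option maxHeartbeats 1600000 in
/-- **The vertex package with the sign made explicit**: as `Tube.exists_vertexData`, recording in
addition that the sign is the Kronecker number `r = ⟨g₀ ⌣ g₁, [Sᵏ × Sᵏ]_μ⟩` of the orientation `μ`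
(so pieces carrying the SAME orientation of `Sᵏ × Sᵏ` get the same sign — the coherence needed for
the definite `E₈` table). [cite: Kosinski1993, VI.(12.3)] -/
theorem Tube.exists_vertexData_sign (hk : 2 ≤ k) (hke : Even k)
    (μ : HomologicalOrientation ℤ ((Metric.sphere (0 : EuclideanSpace ℝ (Fin (k + 1))) 1) ×
      (Metric.sphere (0 : EuclideanSpace ℝ (Fin (k + 1))) 1)) (m + 1 + 1)) :
    ∃ (w : relativeSingularHomology ℤ ℤ (Tube k (m + 1) hkm hc)
        ((𝓡∂ (m + 1 + 1)).boundary (Tube k (m + 1) hkm hc)) (m + 1 + 1))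
      (ξ : singularCohomology ℤ ℤ (ThomSp k (m + 1) hkm hc) k) (r : ℤ),
      IsRelFundamentalClass ℤ ((𝓡∂ (m + 1 + 1)).boundary (Tube k (m + 1) hkm hc)) w ∧
      r = kroneckerPairing ℤ ℤ _ (m + 1 + 1) (cupProduct hkm (g hk 0) (g hk 1)) μ.fundamentalClass ∧
      (r = 1 ∨ r = -1) ∧
      singularCohomology.map ℤ ℤ (subsetIncl (thomDiag (openTubeHomeomorph (hkn := hkm) hc))ᶜ) k ξ = 0 ∧
      (∀ y : ManifoldInterior (m + 1) (Tube k (m + 1) hkm hc),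
        ∃ ζ : localHomology ℤ ℤ (ManifoldInterior (m + 1) (Tube k (m + 1) hkm hc)) y (m + 1 + 1),
          relativeSingularHomology.map ℤ ℤ
              (⟨fun y : ManifoldInterior (m + 1) (Tube k (m + 1) hkm hc) => Tube.toProd hc y.1,
                (contMDiff_out.continuous.comp (RegularSublevel.continuous_incl _)).comp
                  continuous_subtype_val⟩ : C(_, _))
              (LocalFamily.mapsTo_compl_pt ((Tube.toProd_injective hc).comp Subtype.val_injective) y)
              (m + 1 + 1) ζ = μ.localClass (Tube.toProd hc y.1) ∧
          singularHomology.toLocal ℤ ℤ (ClosedModel.ofInterior y) (m + 1 + 1)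
              ((SmaleHomologySpheres.nullCobordismOfBoundary (m + 1)
                (Tube k (m + 1) hkm hc)).closedModelClass ℤ ℤ (Nat.le_add_left 1 m) w) =
            relativeSingularHomology.map ℤ ℤ (NullCobordism.ofInteriorCM
                (SmaleHomologySpheres.nullCobordismOfBoundary (m + 1) (Tube k (m + 1) hkm hc)))
              (LocalFamily.mapsTo_compl_pt (NullCobordism.isOpenEmbedding_ofInteriorCM _).injective y)
              (m + 1 + 1) ζ) ∧
      singularHomology.map ℤ ℤ (tubeCollapse (hkn := hkm) hc) (m + 1 + 1) μ.fundamentalClass =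
        (SmaleHomologySpheres.nullCobordismOfBoundary (m + 1)
          (Tube k (m + 1) hkm hc)).closedModelClass ℤ ℤ (Nat.le_add_left 1 m) w ∧
      capProduct hkm ξ ((SmaleHomologySpheres.nullCobordismOfBoundary (m + 1)
          (Tube k (m + 1) hkm hc)).closedModelClass ℤ ℤ (Nat.le_add_left 1 m) w) =
        r • singularHomology.map ℤ ℤ (tubeCollapse (hkn := hkm) hc) k
          (singularHomology.map ℤ ℤ (diagX k) k (μS hk).fundamentalClass) ∧
      kroneckerPairing ℤ ℤ (ThomSp k (m + 1) hkm hc) k ξ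
          (singularHomology.map ℤ ℤ (tubeCollapse (hkn := hkm) hc) k
            (singularHomology.map ℤ ℤ (diagX k) k (μS hk).fundamentalClass)) = 2 ∧
      (∀ e : Metric.sphere (0 : EuclideanSpace ℝ (Fin (k + 1))) 1,
        kroneckerPairing ℤ ℤ (ThomSp k (m + 1) hkm hc) k ξ (singularHomology.map ℤ ℤ
            ((tubeCollapse (hkn := hkm) hc).comp ⟨fun x => (x, e), by fun_prop⟩) k
              (μS hk).fundamentalClass) = 1 ∧
        kroneckerPairing ℤ ℤ (ThomSp k (m + 1) hkm hc) k ξ (singularHomology.map ℤ ℤ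
            ((tubeCollapse (hkn := hkm) hc).comp ⟨fun x => (e, x), by fun_prop⟩) k
              (μS hk).fundamentalClass) = 1) ∧
      (∀ a : ℤ, a • singularHomology.map ℤ ℤ (tubeCollapse (hkn := hkm) hc) k
          (singularHomology.map ℤ ℤ (diagX k) k (μS hk).fundamentalClass) = 0 → a = 0) := by
  have hc1 : c < 1 := (abs_lt.1 hc).2
  have hΔ : diagonal k ⊆ openTube k c := diagonal_subset_openTube hc1
  -- the Thom class
  obtain ⟨ξ, hξA, hξB⟩ := exists_thomClass (isOpen_openTube k c) (openTubeHomeomorph (hkn := hkm) hc)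
    hk hke hΔ
  -- the collapse and the `μ`-induced relative fundamental class (read on `PM = Sᵏ × Sᵏ`)
  have H := Tube.exists_collapse_fundamentalClass (k := k) (m := m) (hkm := hkm) hc hk
    (μ : HomologicalOrientation ℤ (PM k (m + 1) hkm) (m + 1 + 1))
  obtain ⟨π, w, hH⟩ := H
  have hπq := hH.1
  have hπN := hH.2.1
  have hw := hH.2.2.2.1
  have hLof := hH.2.2.2.2.2.1
  have hclass := hH.2.2.2.2.2.2
  -- the two collapses agree
  have hπc : ∀ x : (Metric.sphere (0 : EuclideanSpace ℝ (Fin (k + 1))) 1) ×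
      (Metric.sphere (0 : EuclideanSpace ℝ (Fin (k + 1))) 1),
      π x = tubeCollapse (hkn := hkm) hc x := by
    intro x
    by_cases hx : x ∈ openTube k c
    · have h1 := tubeCollapse_coe (hkn := hkm) hc ⟨x, hx⟩
      refine Eq.trans ?_ h1.symm
      have h2 := hπq (Tube.ofProd hc x (le_of_lt hx))
      refine h2.trans ?_
      exact boundaryCollapse_of_mem_interior _
    · rw [tubeCollapse_of_not_mem (hkn := hkm) hc hx]
      exact hπN x (not_lt.1 hx)
  have hπeq : (show C((Metric.sphere (0 : EuclideanSpace ℝ (Fin (k + 1))) 1) ×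
      (Metric.sphere (0 : EuclideanSpace ℝ (Fin (k + 1))) 1), ThomSp k (m + 1) hkm hc) from π) =
      (thomCollapse (isOpen_openTube k c) (openTubeHomeomorph (hkn := hkm) hc)) := by
    ext x : 1; exact hπc x
  have hclassS : singularHomology.map ℤ ℤ (show C((Metric.sphere (0 : EuclideanSpace ℝ (Fin (k + 1))) 1) ×
      (Metric.sphere (0 : EuclideanSpace ℝ (Fin (k + 1))) 1), ThomSp k (m + 1) hkm hc) from π)
      (m + 1 + 1) μ.fundamentalClass =
      (SmaleHomologySpheres.nullCobordismOfBoundary (m + 1)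
        (Tube k (m + 1) hkm hc)).closedModelClass ℤ ℤ (Nat.le_add_left 1 m) w := hclass
  rw [hπeq] at hclassS
  -- the model sign `r = ⟨g₁ ⌣ g₂, [X]⟩ = ±1`
  have hrabs : |(kroneckerPairing ℤ ℤ ((Metric.sphere (0 : EuclideanSpace ℝ (Fin (k + 1))) 1) × (Metric.sphere (0 : EuclideanSpace ℝ (Fin (k + 1))) 1)) (m + 1 + 1) (cupProduct hkm (g hk 0) (g hk 1)) μ.fundamentalClass)| = 1 := abs_kroneckerPairing_cupProduct_g hk hkm μ
  have hr1 : (kroneckerPairing ℤ ℤ ((Metric.sphere (0 : EuclideanSpace ℝ (Fin (k + 1))) 1) × (Metric.sphere (0 : EuclideanSpace ℝ (Fin (k + 1))) 1)) (m + 1 + 1) (cupProduct hkm (g hk 0) (g hk 1)) μ.fundamentalClass) = 1 ∨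
      (kroneckerPairing ℤ ℤ ((Metric.sphere (0 : EuclideanSpace ℝ (Fin (k + 1))) 1) × (Metric.sphere (0 : EuclideanSpace ℝ (Fin (k + 1))) 1)) (m + 1 + 1) (cupProduct hkm (g hk 0) (g hk 1)) μ.fundamentalClass) = -1 := (abs_eq zero_le_one).1 hrabs
  -- (`tubeCollapse hc` unfolds to `thomCollapse (isOpen_openTube k c) (openTubeHomeomorph hc)`)
  have hcap := capProduct_thomClass_map_fundamentalClass (isOpen_openTube k c)
    (openTubeHomeomorph (hkn := hkm) hc) hk hke hΔ hkm μ hξA hξB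
  have hdiag := kroneckerPairing_thomClass_map_y_add_y (isOpen_openTube k c)
    (openTubeHomeomorph (hkn := hkm) hc) hk hke hΔ hξA hξB
  have hslice := kroneckerPairing_thomClass_map_sliceAt (isOpen_openTube k c)
    (openTubeHomeomorph (hkn := hkm) hc) hk hke hΔ hξA hξB
  have htors := eq_zero_of_zsmul_map_y_add_y_eq_zero (isOpen_openTube k c)
    (openTubeHomeomorph (hkn := hkm) hc) hk hke hΔ hξA hξB
  have hcap' := (congrArg (capProduct hkm ξ) hclassS).symm.trans hcap
  refine ⟨w, ξ, (kroneckerPairing ℤ ℤ ((Metric.sphere (0 : EuclideanSpace ℝ (Fin (k + 1))) 1) × (Metric.sphere (0 : EuclideanSpace ℝ (Fin (k + 1))) 1)) (m + 1 + 1) (cupProduct hkm (g hk 0) (g hk 1)) μ.fundamentalClass), ?_, rfl, ?_, ?_, fun y => ?_, ?_, ?_, ?_, ?_, fun a ha => ?_⟩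
  · exact hw
  · exact hr1
  · exact hξB
  · exact hLof y
  · exact hclassS
  · rw [hcap', map_diagX_fundamentalClass hk]
    rfl
  · rw [map_diagX_fundamentalClass hk]; exact hdiag
  · exact hslice
  · have e := congrArg (singularHomology.map ℤ ℤ
      (thomCollapse (isOpen_openTube k c) (openTubeHomeomorph (hkn := hkm) hc)) k)
      (map_diagX_fundamentalClass hk)
    exact htors a ((congrArg (fun x => a • x) e).symm.trans ha)

end SphereProd

end Literature.Topology.FourManifolds
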